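import Summits.BirchSwinnertonDyer.BirchSwinnertonDyer.Theorems.ClassRecordThreeEulerHalvesAtThreeEichlerShimuraLevelCountA
import HarnessLib

/-!
# The Shapiro count of parabolic cocycles for a general finite-index level `Γ ∋ -1`, part B:
# parabolic cocycles of `Γ`, the Shapiro lift, and the parabolic condition on the cusp sums

Continuation of `…EichlerShimuraLevelCountA` (verbatim port of the tree's `ParabolicCount`,
`ModularSymbolsParabolicCohomologyProofs`, from `Γ₀(N)` to an arbitrary finite-index `Γ ≤ SL(2, ℤ)`
with `-1 ∈ Γ`). This part defines

* `parabolicCocycles Γ` — the real vector space `Z¹_P(Γ, ℝ) = H¹_P(Γ, ℝ)` of additive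
  `u : Γ → ℝ` vanishing on the parabolic elements of `Γ` (Shimura (8.1.1), (8.1.4) with trivial
  coefficients; the tree's `parabolicCocycles N` is the case `Γ = Γ₀(N)`);
* the transfer elements `liftElem g x = s(gx)⁻¹ g s(x) ∈ Γ` and the Shapiro lift
  `lift u g = (x ↦ u(liftElem g x)) ∈ ℝ^X` with its cocycle identities, the coboundaries `cobd`,
  the cocycle `tot u f = lift u + cobd f`, the vanishing of a cocycle of `SL(2, ℤ) = ⟨S, T⟩` that
  vanishes at `S` and `T`, and
* **the parabolic condition**: the cusp sums of `lift u T` vanish for a parabolic `u`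
  (`cuspSum_lift_T`).

All proofs are those of `ParabolicCount`; no named facts.

## References

* G. Shimura, *Introduction to the arithmetic theory of automorphic functions* (1971), §8.1
  (8.1.1)–(8.1.4), Prop. 8.3.
* K. S. Brown, *Cohomology of groups*, GTM 87 (1982), III.6 (Shapiro's lemma, Prop. 6.2).
-/

noncomputable section

open scoped MatrixGroups ModularForm

open CongruenceSubgroup Matrix.SpecialLinearGroup ModularGroup

set_option linter.dupNamespace false

namespace Summit.BirchSwinnertonDyer.BirchSwinnertonDyer.Theorems.EichlerShimuraLevel

open _root_.Module _root_.LinearMap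
open Literature.NumberTheory.EllipticCurves.ModularForms
open scoped Classical

variable {Γ : Subgroup SL(2, ℤ)}

/-! ### Parabolic cocycles of a level `Γ` -/

variable (Γ) in
/-- **The parabolic cohomology `H¹_P(Γ, ℝ)` of a level `Γ ≤ SL(2, ℤ)` with trivial real
coefficients**, realised as the space of *parabolic cocycles*: additive `u : Γ → ℝ`
(`u(γδ) = u(γ) + u(δ)`) with `u(π) = 0` for every parabolic `π ∈ Γ` (Mathlib's `Matrix.IsParabolic`
for the integral matrix of `π`). For `Γ = Γ₀(N)` this is the tree's `parabolicCocycles N`.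
[cite: ShimuraIATAF1971, §8.1 (8.1.1), (8.1.4)] -/
def parabolicCocycles : Submodule ℝ (Γ → ℝ) where
  carrier := {u | (∀ γ δ : Γ, u (γ * δ) = u γ + u δ) ∧
    ∀ γ : Γ, ((γ : SL(2, ℤ)) : Matrix (Fin 2) (Fin 2) ℤ).IsParabolic → u γ = 0}
  add_mem' := by
    rintro u v ⟨hu, hu'⟩ ⟨hv, hv'⟩
    refine ⟨fun γ δ ↦ ?_, fun γ hγ ↦ ?_⟩
    · simp only [Pi.add_apply, hu, hv]; ring
    · simp [hu' γ hγ, hv' γ hγ]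
  zero_mem' := ⟨fun _ _ ↦ by simp, fun _ _ ↦ rfl⟩
  smul_mem' := by
    rintro c u ⟨hu, hu'⟩
    refine ⟨fun γ δ ↦ ?_, fun γ hγ ↦ ?_⟩
    · simp only [Pi.smul_apply, hu, smul_eq_mul]; ring
    · simp [hu' γ hγ]

/-- Unfolding `parabolicCocycles`. [folklore] -/
theorem mem_parabolicCocycles_iff {u : Γ → ℝ} :
    u ∈ parabolicCocycles Γ ↔ (∀ γ δ : Γ, u (γ * δ) = u γ + u δ) ∧
      ∀ γ : Γ, ((γ : SL(2, ℤ)) : Matrix (Fin 2) (Fin 2) ℤ).IsParabolic → u γ = 0 :=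
  Iff.rfl

/-! ### Shapiro's lemma made explicit: cocycles of `SL(2, ℤ)` in `ℝ^X` from homomorphisms of `Γ` -/

/-- A set-theoretic section of `SL(2, ℤ) → X = SL(2, ℤ)/Γ`. [folklore] -/
def sec (x : (SL(2, ℤ) ⧸ Γ)) : SL(2, ℤ) := Quotient.out x

/-- `sec x` represents `x`. [folklore] -/
@[simp] theorem coe_sec (x : (SL(2, ℤ) ⧸ Γ)) : (sec x : (SL(2, ℤ) ⧸ Γ)) = x :=
  QuotientGroup.out_eq' x

/-- `s(gx)⁻¹ g s(x) ∈ Γ`. [folklore] -/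
theorem sec_smul_inv_mul_mem (g : SL(2, ℤ)) (x : (SL(2, ℤ) ⧸ Γ)) :
    (sec (g • x))⁻¹ * g * sec x ∈ Γ := by
  rw [mul_assoc, ← QuotientGroup.eq, coe_sec, ← smul_eq_mul, ← MulAction.Quotient.smul_mk, coe_sec]

/-- The **transfer element** `ℓ(g, x) = s(gx)⁻¹ g s(x) ∈ Γ` of `g ∈ SL(2, ℤ)` at `x ∈ X`.
[folklore] -/
def liftElem (g : SL(2, ℤ)) (x : (SL(2, ℤ) ⧸ Γ)) : Γ :=
  ⟨(sec (g • x))⁻¹ * g * sec x, sec_smul_inv_mul_mem g x⟩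

/-- Unfolding `liftElem`. [folklore] -/
@[simp] theorem coe_liftElem (g : SL(2, ℤ)) (x : (SL(2, ℤ) ⧸ Γ)) :
    (liftElem g x : SL(2, ℤ)) = (sec (g • x))⁻¹ * g * sec x := rfl

/-- The cocycle identity of the transfer: `ℓ(gh, x) = ℓ(g, hx) ℓ(h, x)`. [folklore] -/
theorem liftElem_mul (g h : SL(2, ℤ)) (x : (SL(2, ℤ) ⧸ Γ)) :
    liftElem (g * h) x = liftElem g (h • x) * liftElem h x := by
  apply Subtype.ext
  simp only [coe_liftElem, Subgroup.coe_mul, mul_smul]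
  group

/-- `ℓ(1, x) = 1`. [folklore] -/
theorem liftElem_one (x : (SL(2, ℤ) ⧸ Γ)) : liftElem (Γ := Γ) 1 x = 1 := by
  apply Subtype.ext
  simp

/-- `ℓ(-1, x) = -1`. [folklore] -/
theorem coe_liftElem_neg_one [Fact ((-1 : SL(2, ℤ)) ∈ Γ)] (x : (SL(2, ℤ) ⧸ Γ)) :
    (liftElem (Γ := Γ) (-1) x : SL(2, ℤ)) = -1 := by
  simp [neg_one_smul_coset']

/-- `γ ∈ Γ` fixes the identity coset. [folklore] -/
theorem smul_coe_one_of_mem {γ : SL(2, ℤ)} (hγ : γ ∈ Γ) :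
    γ • ((1 : SL(2, ℤ)) : (SL(2, ℤ) ⧸ Γ)) = ((1 : SL(2, ℤ)) : (SL(2, ℤ) ⧸ Γ)) := by
  rw [MulAction.Quotient.smul_mk, smul_eq_mul, mul_one, QuotientGroup.eq, mul_one]
  exact inv_mem hγ

/-- `s(Γ) ∈ Γ`. [folklore] -/
theorem sec_one_mem : sec ((1 : SL(2, ℤ)) : (SL(2, ℤ) ⧸ Γ)) ∈ Γ := by
  have h := coe_sec ((1 : SL(2, ℤ)) : (SL(2, ℤ) ⧸ Γ))
  rw [QuotientGroup.eq, mul_one] at h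
  exact inv_mem_iff.mp h

/-- `u(1) = 0` for an additive `u : Γ → ℝ`. [folklore] -/
theorem map_one_of_additive {u : Γ → ℝ} (hu : ∀ γ δ, u (γ * δ) = u γ + u δ) : u 1 = 0 := by
  have h := hu 1 1
  rw [mul_one] at h
  linarith

/-- `u(γ⁻¹) = -u(γ)` for an additive `u : Γ → ℝ`. [folklore] -/
theorem map_inv_of_additive {u : Γ → ℝ} (hu : ∀ γ δ, u (γ * δ) = u γ + u δ) (γ : Γ) :
    u γ⁻¹ = -u γ := by
  have h := hu γ⁻¹ γ
  rw [inv_mul_cancel, map_one_of_additive hu] at h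
  linarith

/-- The **Shapiro lift** `E_u(g) = (x ↦ u(s(gx)⁻¹ g s(x))) ∈ ℝ^X` of a function `u : Γ → ℝ`
at `g ∈ SL(2, ℤ)` (the explicit inverse of the Shapiro isomorphism
`H¹(SL(2, ℤ), Coind ℝ) ≅ H¹(Γ, ℝ)` on cocycles). [folklore] -/
def lift (u : Γ → ℝ) (g : SL(2, ℤ)) : (SL(2, ℤ) ⧸ Γ) → ℝ := fun x ↦ u (liftElem g x)

/-- Unfolding `lift`. [folklore] -/
@[simp] theorem lift_apply (u : Γ → ℝ) (g : SL(2, ℤ)) (x : (SL(2, ℤ) ⧸ Γ)) :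
    lift u g x = u (liftElem g x) := rfl

/-- The coboundary `δf(g) = g^* f - f` of `f ∈ ℝ^X`. [folklore] -/
def cobd (f : (SL(2, ℤ) ⧸ Γ) → ℝ) (g : SL(2, ℤ)) : (SL(2, ℤ) ⧸ Γ) → ℝ := coperm Γ g f - f

/-- Coboundaries are cocycles: `δf(gh) = h^* δf(g) + δf(h)`. [folklore] -/
theorem cobd_mul (f : (SL(2, ℤ) ⧸ Γ) → ℝ) (g h : SL(2, ℤ)) :
    cobd f (g * h) = coperm Γ h (cobd f g) + cobd f h := by
  simp only [cobd, coperm_mul, LinearMap.comp_apply, map_sub]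
  abel

/-- `δf(1) = 0`. [folklore] -/
theorem cobd_one (f : (SL(2, ℤ) ⧸ Γ) → ℝ) : cobd f 1 = 0 := by
  simp [cobd, coperm_one]

/-- `δf(-1) = 0`. [folklore] -/
theorem cobd_neg_one [Fact ((-1 : SL(2, ℤ)) ∈ Γ)] (f : (SL(2, ℤ) ⧸ Γ) → ℝ) : cobd f (-1) = 0 := by
  simp [cobd, coperm_neg_one]

/-- Coboundaries restrict to zero on `Γ`: `δf(γ)(Γ) = 0`. [folklore] -/
theorem cobd_apply_coe_one (f : (SL(2, ℤ) ⧸ Γ) → ℝ) (γ : Γ) :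
    cobd f γ ((1 : SL(2, ℤ)) : (SL(2, ℤ) ⧸ Γ)) = 0 := by
  simp [cobd, smul_coe_one_of_mem γ.2]

/-- The cocycle `E_u + δf`. [folklore] -/
def tot (u : Γ → ℝ) (f : (SL(2, ℤ) ⧸ Γ) → ℝ) (g : SL(2, ℤ)) : (SL(2, ℤ) ⧸ Γ) → ℝ :=
  lift u g + cobd f g

section Additive

variable {u : Γ → ℝ} (hu : ∀ γ δ, u (γ * δ) = u γ + u δ)
include hu

/-- **The Shapiro lift of a homomorphism is a cocycle**: `E(gh) = h^* E(g) + E(h)`. [folklore] -/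
theorem lift_mul (g h : SL(2, ℤ)) : lift u (g * h) = coperm Γ h (lift u g) + lift u h := by
  funext x
  simp only [lift_apply, Pi.add_apply, coperm_apply, liftElem_mul, hu]

/-- `E(1) = 0`. [folklore] -/
theorem lift_one : lift u 1 = 0 := by
  funext x
  simp [liftElem_one, map_one_of_additive hu]

/-- `E(-1) = 0` (`u(-1) = 0` as `2u(-1) = u(1) = 0`). [folklore] -/
theorem lift_neg_one [Fact ((-1 : SL(2, ℤ)) ∈ Γ)] : lift u (-1) = 0 := by
  funext x
  simp only [lift_apply, Pi.zero_apply]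
  have hm : liftElem (Γ := Γ) (-1) x * liftElem (-1) x = 1 :=
    Subtype.ext (by simp [neg_one_smul_coset'])
  have h := hu (liftElem (-1) x) (liftElem (-1) x)
  rw [hm, map_one_of_additive hu] at h
  linarith

/-- **The lift restricts to `u` on `Γ`**: `E_u(γ)(Γ) = u(s₀⁻¹γs₀) = u(γ)`. [folklore] -/
theorem lift_apply_coe_one (γ : Γ) : lift u γ ((1 : SL(2, ℤ)) : (SL(2, ℤ) ⧸ Γ)) = u γ := by
  have h1 : liftElem (γ : SL(2, ℤ)) ((1 : SL(2, ℤ)) : (SL(2, ℤ) ⧸ Γ)) =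
      (⟨sec ((1 : SL(2, ℤ)) : (SL(2, ℤ) ⧸ Γ)), sec_one_mem⟩ : Γ)⁻¹ * γ *
        ⟨sec ((1 : SL(2, ℤ)) : (SL(2, ℤ) ⧸ Γ)), sec_one_mem⟩ :=
    Subtype.ext (by simp [smul_coe_one_of_mem γ.2])
  rw [lift_apply, h1, hu, hu, map_inv_of_additive hu]
  ring

/-- `(E_u + δf)(gh) = h^*(E_u + δf)(g) + (E_u + δf)(h)`. [folklore] -/
theorem tot_mul (f : (SL(2, ℤ) ⧸ Γ) → ℝ) (g h : SL(2, ℤ)) :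
    tot u f (g * h) = coperm Γ h (tot u f g) + tot u f h := by
  simp only [tot, lift_mul hu, cobd_mul, map_add]
  abel

/-- `(E_u + δf)(1) = 0`. [folklore] -/
theorem tot_one (f : (SL(2, ℤ) ⧸ Γ) → ℝ) : tot u f 1 = 0 := by
  simp [tot, lift_one hu, cobd_one]

/-- `(E_u + δf)(-1) = 0`. [folklore] -/
theorem tot_neg_one [Fact ((-1 : SL(2, ℤ)) ∈ Γ)] (f : (SL(2, ℤ) ⧸ Γ) → ℝ) : tot u f (-1) = 0 := by
  simp [tot, lift_neg_one hu, cobd_neg_one]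

/-- `(E_u + δf)(g⁻¹) = -(g⁻¹)^*(E_u + δf)(g)`. [folklore] -/
theorem tot_inv (f : (SL(2, ℤ) ⧸ Γ) → ℝ) (g : SL(2, ℤ)) :
    tot u f g⁻¹ = -coperm Γ g⁻¹ (tot u f g) := by
  have h := tot_mul hu f g g⁻¹
  rw [mul_inv_cancel, tot_one hu] at h
  exact eq_neg_of_add_eq_zero_right h.symm

/-- `(E_u + δf)(γ)(Γ) = u(γ)` for `γ ∈ Γ`. [folklore] -/
theorem tot_apply_coe_one (f : (SL(2, ℤ) ⧸ Γ) → ℝ) (γ : Γ) :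
    tot u f γ ((1 : SL(2, ℤ)) : (SL(2, ℤ) ⧸ Γ)) = u γ := by
  simp only [tot, Pi.add_apply, lift_apply_coe_one hu, cobd_apply_coe_one, add_zero]

/-- **A cocycle of `SL(2, ℤ) = ⟨S, T⟩` vanishing at `S` and `T` vanishes.** [folklore] -/
theorem tot_eq_zero_of_S_T (f : (SL(2, ℤ) ⧸ Γ) → ℝ) (hS : tot u f S = 0) (hT : tot u f T = 0)
    (g : SL(2, ℤ)) : tot u f g = 0 := by
  have hg : g ∈ Subgroup.closure ({S, T} : Set SL(2, ℤ)) := by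
    rw [SpecialLinearGroup.SL2Z_generators]
    exact Subgroup.mem_top g
  induction hg using Subgroup.closure_induction with
  | mem x hx =>
    rcases hx with rfl | rfl
    · exact hS
    · exact hT
  | one => exact tot_one hu f
  | mul x y _ _ hx hy => rw [tot_mul hu, hx, hy, map_zero, add_zero]
  | inv x _ hx => rw [tot_inv hu, hx, map_zero, neg_zero]

/-- `E_u(Tⁿ)(x) = ∑_{i<n} E_u(T)(Tⁱx)`. [folklore] -/
theorem lift_T_pow_apply (n : ℕ) (x : (SL(2, ℤ) ⧸ Γ)) :
    lift u (T ^ n) x = ∑ i ∈ Finset.range n, lift u T (T ^ i • x) := by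
  induction n generalizing x with
  | zero => rw [pow_zero, lift_one hu]; simp
  | succ n ih =>
    rw [pow_succ, lift_mul hu, Pi.add_apply, coperm_apply, ih, Finset.sum_range_succ', pow_zero,
      one_smul]
    simp_rw [smul_smul, ← pow_succ]

end Additive

/-! ### The parabolic condition: cusp sums of `E_u(T)` vanish -/

/-- **`E_u(T^w)(x) = u(s(x)⁻¹ T^w s(x)) = 0` for a parabolic cocycle `u` when `T^w x = x`,
`w ≠ 0`** (`s(x)⁻¹T^ws(x)` is parabolic). [folklore] -/
theorem lift_T_pow_apply_eq_zero (u : parabolicCocycles Γ) {w : ℕ} (hw : w ≠ 0)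
    {x : (SL(2, ℤ) ⧸ Γ)} (hx : T ^ w • x = x) : lift (u : Γ → ℝ) (T ^ w) x = 0 := by
  rw [lift_apply]
  apply (mem_parabolicCocycles_iff.mp u.2).2
  rw [coe_liftElem, hx]
  exact ParabolicCount.isParabolic_conj (ParabolicCount.isParabolic_T_pow hw) (sec x)

/-- **The cusp sums of `E_u(T)` vanish** for a parabolic cocycle `u` (finite-index `Γ`): over the
orbit of a base point `x` of width `w`, `∑_{i<w} E_u(T)(Tⁱx) = E_u(T^w)(x) = 0`. [folklore] -/
theorem cuspSum_lift_T [Γ.FiniteIndex] (u : parabolicCocycles Γ) :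
    cuspSum Γ (lift (u : Γ → ℝ) T) = 0 := by
  funext p
  obtain ⟨p, hp⟩ := p
  rw [cuspSum_apply, Pi.zero_apply, Level.sum_orbitFin_eq,
    ← lift_T_pow_apply (mem_parabolicCocycles_iff.mp u.2).1 (Level.width Γ p) p]
  exact lift_T_pow_apply_eq_zero u (Level.width_pos Γ p).ne' (Level.T_pow_width_smul Γ p)

end Summit.BirchSwinnertonDyer.BirchSwinnertonDyer.Theorems.EichlerShimuraLevel

end
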